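import Summits.AtomisticToContinuum.Crystallization.Theorems.ChartedZeroExcessLayeredLatticeLiouvilleUH

/-!
# Charted zero-excess layered-lattice Liouville — YJ-A «SecantLadder»: the dyadic secant calculus (lens-2 g66; docket `stmt-AtomisticToContinuum-26636`)

Part 1 of 4 of node g66 «SecantLadder + NearFarShellSplit» (lens «structural dichotomy (special vs generic)», generation 66), the typed discharge ladder beneath
the amplitude half (QC) `MildClampedConvexityP` of part YI's variational split of the mild clamped door [MCMCᶜ] (CRITIC-LEDGER row 1194 (b‴): «(QC) … DECISION BY
INSTRUMENT FIRST; CERT-able»).  THIS FILE IS PURE ONE-VARIABLE CALCULUS, ALL PROVED, and imports the tree part UH only (it can land at any time):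

* **YJ-1 the DYADIC SECANT LEMMA.**  `secondDiff g t := g t − 2·g(t/2) + g 0`; the telescoping identity
  `g 1 − g 0 = 2ᴺ·(g 2⁻ᴺ − g 0) + Σ_{n<N} 2ⁿ·Δ²g(2⁻ⁿ)` (`sub_eq_dyadic_telescope`); hence (`two_mul_le_sub_of_secondDiff_floor`) if `g′(0) = 0` and
  `Δ²g(t) ≥ c·t²` for `t ∈ (0,1]` then `g 1 − g 0 ≥ 2c`.  Along the MATCHED SEGMENT `segConf y xf τ = y + τ·(xf − y)` of two atom families this turns a
  second-difference floor `(κ/2)·t²·Σ dist²` of ANY energy `E` that is critical at `y` into `E y + κ·Σᵢ dist(xf i, y i)² ≤ E xf`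
  (`add_mul_sum_sq_le_of_secondDiff_floor`) — the conclusion of (QC), with no second derivative of `E` ever mentioned.
* **YJ-4 HESSIAN FLOOR ⇒ SECANT FLOOR** (`le_secondDiff_of_deriv2_floor`): `g″ ≥ m` on `[0,1]` gives `Δ²g(t) ≥ m·t²/4` — the adapter through which a certified
  stiffness (smallest-eigenvalue) floor discharges a secant floor (part YJ's `nearSecantFloorP_of_hessianFloor`).

Sequels: part YJ-B (the Lennard-Jones one-bond estimate, the near/far shell split of the clamped energy and the PROVED far-field bound), part YJ-C (the typed
ladder (QS) ⟸ (QSⁿ) ∧ (QSᶠ) ⟸ (QH), (TM) over tree vocabulary, and the PROVED door-set tail moment), part YJ (after part YI: (QS) ⇒ (QC), the secant mild dockets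
and the columns `_16XH28BW` / `_16XH28BWT` / `_16XH28BX` / `_16XH28BXT`).
-/

noncomputable section

open scoped BigOperators Classical
open Set Metric Filter Topology
open Summit.AtomisticToContinuum.Crystallization.Theorems.ChartedPlanarOrderRigidityDoor (E3)

namespace Summit.AtomisticToContinuum.Crystallization.Theorems.ChartedZeroExcessLayeredLatticeLiouville

/-! ### YJ-1  The dyadic secant lemma and the matched segment (PROVED) -/

/-- the SECOND DIFFERENCE of `g : ℝ → ℝ` at base `0` with half-step: `g t − 2·g (t/2) + g 0`. -/
def secondDiff (g : ℝ → ℝ) (t : ℝ) : ℝ := g t - 2 * g (t / 2) + g 0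

/-- `secondDiff_add` (docstring added by the landing lane; see the module docstring). [formal bookkeeping] -/
theorem secondDiff_add (g₁ g₂ : ℝ → ℝ) (t : ℝ) :
    secondDiff (fun τ => g₁ τ + g₂ τ) t = secondDiff g₁ t + secondDiff g₂ t := by
  unfold secondDiff; ring

/-- dyadic telescoping: `g 1 − g 0 = 2^N·(g 2⁻ᴺ − g 0) + Σ_{n<N} 2^n·Δ²g(2⁻ⁿ)`. -/
theorem sub_eq_dyadic_telescope (g : ℝ → ℝ) (N : ℕ) :
    g 1 - g 0 = 2 ^ N * (g ((1 / 2) ^ N) - g 0) + ∑ n ∈ Finset.range N, 2 ^ n * secondDiff g ((1 / 2) ^ n) := by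
  induction N with
  | zero => simp
  | succ N ih =>
    rw [Finset.sum_range_succ, ih]
    have h2 : ((1 : ℝ) / 2) ^ N / 2 = (1 / 2) ^ (N + 1) := by rw [pow_succ]; ring
    unfold secondDiff
    rw [h2, pow_succ, pow_succ]
    ring

/-- ★ **THE DYADIC SECANT LEMMA (PROVED).**  If `g` has derivative `0` at `0` and its second differences obey the floor `c·t² ≤ g t − 2 g(t/2) + g 0`
for `t ∈ (0, 1]`, then `2c ≤ g 1 − g 0`: telescoping over the dyadic scales `t = 2⁻ⁿ` and `2ᴺ·(g 2⁻ᴺ − g 0) → g′(0) = 0`. -/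
theorem two_mul_le_sub_of_secondDiff_floor {g : ℝ → ℝ} {c : ℝ} (hg : HasDerivAt g 0 0)
    (h : ∀ t : ℝ, 0 < t → t ≤ 1 → c * t ^ 2 ≤ secondDiff g t) : 2 * c ≤ g 1 - g 0 := by
  -- the slope sequence along `2⁻ᴺ` tends to `g′(0) = 0`
  have hseq : Tendsto (fun N : ℕ => ((1 : ℝ) / 2) ^ N) atTop (𝓝[≠] 0) := by
    refine tendsto_nhdsWithin_iff.2 ⟨tendsto_pow_atTop_nhds_zero_of_lt_one (by norm_num) (by norm_num), ?_⟩
    exact Eventually.of_forall fun N => by simp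
  have hslope : Tendsto (fun N : ℕ => (((1 : ℝ) / 2) ^ N)⁻¹ • (g (0 + (1 / 2) ^ N) - g 0)) atTop (𝓝 0) :=
    hg.tendsto_slope_zero.comp hseq
  have hpow : Tendsto (fun N : ℕ => ((1 : ℝ) / 2) ^ N) atTop (𝓝 0) :=
    tendsto_pow_atTop_nhds_zero_of_lt_one (by norm_num) (by norm_num)
  have hlim : Tendsto (fun N : ℕ => 2 ^ N * (g ((1 / 2) ^ N) - g 0) + c * (2 * (1 - (1 / 2) ^ N))) atTop
      (𝓝 (0 + c * (2 * (1 - 0)))) := by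
    refine Tendsto.add ?_ (((tendsto_const_nhds.sub hpow).const_mul 2).const_mul c)
    refine hslope.congr fun N => ?_
    rw [zero_add, smul_eq_mul, one_div, inv_pow, inv_inv]
  have hbound : ∀ N : ℕ, 2 ^ N * (g ((1 / 2) ^ N) - g 0) + c * (2 * (1 - (1 / 2) ^ N)) ≤ g 1 - g 0 := by
    intro N
    rw [sub_eq_dyadic_telescope g N]
    have hgeom : ∑ n ∈ Finset.range N, ((1 : ℝ) / 2) ^ n = 2 * (1 - (1 / 2) ^ N) := by
      rw [geom_sum_eq (by norm_num : (1 : ℝ) / 2 ≠ 1)]; ring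
    have hterm : ∀ n ∈ Finset.range N, c * (1 / 2) ^ n ≤ 2 ^ n * secondDiff g ((1 / 2) ^ n) := by
      intro n _
      have hfl := h ((1 / 2) ^ n) (by positivity) (pow_le_one₀ (by norm_num) (by norm_num))
      have h22 : (2 : ℝ) ^ n * (1 / 2) ^ n = 1 := by rw [← mul_pow]; norm_num
      have h4 : (2 : ℝ) ^ n * (c * ((1 / 2) ^ n) ^ 2) = c * (1 / 2) ^ n := by
        calc (2 : ℝ) ^ n * (c * ((1 / 2) ^ n) ^ 2) = c * (1 / 2) ^ n * (2 ^ n * (1 / 2) ^ n) := by ring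
          _ = c * (1 / 2) ^ n := by rw [h22, mul_one]
      calc c * (1 / 2) ^ n = 2 ^ n * (c * ((1 / 2) ^ n) ^ 2) := h4.symm
        _ ≤ 2 ^ n * secondDiff g ((1 / 2) ^ n) := mul_le_mul_of_nonneg_left hfl (by positivity)
    have := Finset.sum_le_sum hterm
    rw [← Finset.mul_sum, hgeom] at this
    linarith
  have := le_of_tendsto' hlim hbound
  linarith


/-- the matched SEGMENT between two finite configurations: `segment y xf t = (1 − t)·y + t·xf` sitewise. -/
def segConf {n : ℕ} (y xf : Fin n → E3) (t : ℝ) : Fin n → E3 := fun i => y i + t • (xf i - y i)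

/-- `segConf_zero` (docstring added by the landing lane; see the module docstring). [formal bookkeeping] -/
@[simp] theorem segConf_zero {n : ℕ} (y xf : Fin n → E3) : segConf y xf 0 = y := by
  funext i; simp [segConf]

/-- `segConf_one` (docstring added by the landing lane; see the module docstring). [formal bookkeeping] -/
@[simp] theorem segConf_one {n : ℕ} (y xf : Fin n → E3) : segConf y xf 1 = xf := by
  funext i; simp [segConf]

/-- `hasDerivAt_segConf` (docstring added by the landing lane; see the module docstring). [formal bookkeeping] -/
theorem hasDerivAt_segConf {n : ℕ} (y xf : Fin n → E3) (t : ℝ) :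
    HasDerivAt (segConf y xf) (xf - y) t := by
  have h : HasDerivAt (fun τ : ℝ => y + τ • (xf - y)) ((1 : ℝ) • (xf - y)) t :=
    ((hasDerivAt_id t).smul_const (xf - y)).const_add y
  rw [one_smul] at h
  refine h.congr_of_eventuallyEq (Eventually.of_forall fun τ => ?_)
  funext i; simp [segConf]

/-- along a matched segment, a CRITICAL energy has derivative `0` at the base (chain rule). -/
theorem hasDerivAt_comp_segConf_zero {n : ℕ} {E : (Fin n → E3) → ℝ} {y : Fin n → E3} (xf : Fin n → E3)
    (hE : HasFDerivAt E (0 : (Fin n → E3) →L[ℝ] ℝ) y) : HasDerivAt (fun t => E (segConf y xf t)) 0 0 := by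
  have hy : segConf y xf 0 = y := segConf_zero y xf
  have hE' : HasFDerivAt E (0 : (Fin n → E3) →L[ℝ] ℝ) (segConf y xf 0) := by rw [hy]; exact hE
  have h2 := hE'.comp_hasDerivAt (0 : ℝ) (hasDerivAt_segConf y xf 0)
  rw [show ((0 : (Fin n → E3) →L[ℝ] ℝ) (xf - y)) = 0 from rfl] at h2
  exact h2

/-- ★ **SECANT FLOOR + CRITICALITY ⇒ STRONG-CONVEXITY INEQUALITY (PROVED, energy-agnostic).**  For ANY energy `E` on `Fin n → E3` with a critical point
`y` and any `xf`: the second-difference floor `κ/2·t²·Σ dist² ≤ Δ²_t E(segment)` on `t ∈ (0,1]` gives `E y + κ·Σᵢ dist(xf i, y i)² ≤ E xf`. -/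
theorem add_mul_sum_sq_le_of_secondDiff_floor {n : ℕ} {E : (Fin n → E3) → ℝ} {y xf : Fin n → E3} {κ : ℝ}
    (hE : HasFDerivAt E (0 : (Fin n → E3) →L[ℝ] ℝ) y)
    (h : ∀ t : ℝ, 0 < t → t ≤ 1 → κ / 2 * t ^ 2 * ∑ i, dist (xf i) (y i) ^ 2 ≤ secondDiff (fun τ => E (segConf y xf τ)) t) :
    E y + κ * ∑ i, dist (xf i) (y i) ^ 2 ≤ E xf := by
  have key := two_mul_le_sub_of_secondDiff_floor (c := κ / 2 * ∑ i, dist (xf i) (y i) ^ 2) (hasDerivAt_comp_segConf_zero xf hE)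
    (fun t ht ht1 => by have := h t ht ht1; linarith [this, show κ / 2 * t ^ 2 * ∑ i, dist (xf i) (y i) ^ 2 = κ / 2 * (∑ i, dist (xf i) (y i) ^ 2) * t ^ 2 by ring])
  simp only [segConf_one, segConf_zero] at key
  linarith

/-! ### Hessian floor ⇒ secant floor (PROVED): the bridge from a stiffness CERTIFICATE to the second-difference floor -/

/-- ★ **HESSIAN FLOOR ⇒ SECANT FLOOR (PROVED).**  If `g` is twice differentiable on `[0,1]` with `g'' ≥ m` there, then
`g(t) − 2·g(t/2) + g(0) ≥ m·t²/4` for every `t ∈ (0,1]` (two mean-value slopes of the function `g − (m/2)·τ²`, whose derivative is monotone). -/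
theorem le_secondDiff_of_deriv2_floor {g g' g'' : ℝ → ℝ} {m t : ℝ}
    (hg : ∀ τ : ℝ, 0 ≤ τ → τ ≤ 1 → HasDerivAt g (g' τ) τ) (hg' : ∀ τ : ℝ, 0 ≤ τ → τ ≤ 1 → HasDerivAt g' (g'' τ) τ)
    (hm : ∀ τ : ℝ, 0 ≤ τ → τ ≤ 1 → m ≤ g'' τ) (ht : 0 < t) (ht1 : t ≤ 1) :
    m * t ^ 2 / 4 ≤ secondDiff g t := by
  set h : ℝ → ℝ := fun τ => g τ - m / 2 * (τ * τ) with hh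
  set h' : ℝ → ℝ := fun τ => g' τ - m * τ with hh'
  have hd : ∀ τ : ℝ, 0 ≤ τ → τ ≤ 1 → HasDerivAt h (h' τ) τ := by
    intro τ h0 h1
    exact ((hg τ h0 h1).sub (((hasDerivAt_id' τ).mul (hasDerivAt_id' τ)).const_mul (m / 2))).congr_deriv (by ring)
  have hd' : ∀ τ : ℝ, 0 ≤ τ → τ ≤ 1 → HasDerivAt h' (g'' τ - m) τ := by
    intro τ h0 h1
    exact ((hg' τ h0 h1).sub ((hasDerivAt_id' τ).const_mul m)).congr_deriv (by ring)
  have hmono : MonotoneOn h' (Icc 0 1) := by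
    apply monotoneOn_of_hasDerivWithinAt_nonneg (convex_Icc 0 1) (f' := fun τ => g'' τ - m)
    · intro x hx; exact (hd' x hx.1 hx.2).continuousAt.continuousWithinAt
    · intro x hx; rw [interior_Icc] at hx; exact (hd' x hx.1.le hx.2.le).hasDerivWithinAt
    · intro x hx; rw [interior_Icc] at hx; linarith [hm x hx.1.le hx.2.le]
  have hC : ∀ a b : ℝ, 0 ≤ a → b ≤ 1 → ContinuousOn h (Icc a b) :=
    fun a b ha hb x hx => (hd x (le_trans ha hx.1) (le_trans hx.2 hb)).continuousAt.continuousWithinAt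
  obtain ⟨ξ₁, hξ₁, e₁⟩ := exists_hasDerivAt_eq_slope h h' (by linarith : t / 2 < t)
    (hC _ _ (by linarith) ht1) (fun x hx => hd x (by linarith [hx.1]) (by linarith [hx.2]))
  obtain ⟨ξ₂, hξ₂, e₂⟩ := exists_hasDerivAt_eq_slope h h' (by linarith : (0:ℝ) < t / 2)
    (hC _ _ le_rfl (by linarith)) (fun x hx => hd x (by linarith [hx.1]) (by linarith [hx.2]))
  have hle : h' ξ₂ ≤ h' ξ₁ :=
    hmono ⟨hξ₂.1.le, by linarith [hξ₂.2]⟩ ⟨by linarith [hξ₁.1], by linarith [hξ₁.2]⟩ (by linarith [hξ₂.2, hξ₁.1])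
  have hne2' : t / 2 ≠ 0 := by linarith
  have q1 : h t - h (t / 2) = h' ξ₁ * (t / 2) := by
    rw [e₁, show t - t / 2 = t / 2 by ring, div_mul_cancel₀ _ hne2']
  have q2 : h (t / 2) - h 0 = h' ξ₂ * (t / 2) := by
    rw [e₂, sub_zero, div_mul_cancel₀ _ hne2']
  have hsd : secondDiff h t = t / 2 * (h' ξ₁ - h' ξ₂) := by
    have : secondDiff h t = (h t - h (t / 2)) - (h (t / 2) - h 0) := by unfold secondDiff; ring
    rw [this, q1, q2]; ring
  have hsd0 : 0 ≤ secondDiff h t := by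
    rw [hsd]; exact mul_nonneg (by linarith) (by linarith)
  have hrel : secondDiff g t = secondDiff h t + m * t ^ 2 / 4 := by
    simp only [secondDiff, hh]; ring
  rw [hrel]; linarith

end Summit.AtomisticToContinuum.Crystallization.Theorems.ChartedZeroExcessLayeredLatticeLiouville

end
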